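import Mathlib
import Literature.MathematicalPhysics.QuantumFieldTheory.Balaban1983to89.Beta.CombesThomasKernel

/-!
# Beta / CombesThomasKernelTail — exponential-tail packaging of the non-local-kernel defect hypothesis:
`cosh(λt) − 1 ≤ λ²(cosh t − 1)` for `0 ≤ λ ≤ 1`, hence ONE exponential moment of `K` at rate `κ` controls the
Combes–Thomas defect at every rate `δ ≤ κ`, to second order in `δ`

HONEST FRAMING (verbatim, page 1 of everything this cell writes): discharging `BetaPertH` makes Bałaban's UV
stability UNCONDITIONAL — a real constructive-QFT result; it is NOT the continuum limit and NOT the Clay problem.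
Gloss (BETA-SPEC v1.9b l. 17–18, G-ref2-14 (a) / G-ref2-20 (a), verbatim): «UNCONDITIONAL» in [Balaban1989LargeFieldII]
(B16, CMP 122) p. 355's interval-hypothesis sense ONLY (`FlowStepRuns.p355Unconditional_of_partialSums` keeps `hnodes`);
the located leaves G-adv3-2 (left inequality of (0.1)/(2.50), d = 4), G-adv3-1 (U2 transfer of B14 Cor. 3's lower
bound) and `SecondExpLeaf` REMAIN.  Gloss 2 (BETA-SPEC v1.9e 22:38Z, beta-ref C-beta-78, BINDING, verbatim): «UNCONDITIONAL» =
`Beta.Assembly.EventualForm`-unconditional — the END statement with the interval hypothesis removed, (0.31) in DEFECTED form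
on all lattices (`PrefixAbsorption.thm2Defected_of_eventualForm`), admissible couplings shrunk to g ≤ g⋆; NOT «B12 Theorem 2 as
printed» (that needs (AF-0s) or (AF-0-L) ∀k at L ≥ L₁ in addition: `eventualForm_not_thm2Printed`, RULING (R6)); never the
continuum limit / mass gap / Clay.  THIS MODULE discharges nothing of that and makes NO UV-stability claim at all: it
is a Mathlib-elementary kernel certificate.

SCOPE.  Mathlib-elementary; nothing printed by Bałaban is asserted, no hypothesis is a quotation.  The sibling
`CombesThomasKernel` bounds the conjugation defect of a symmetric real kernel `K` added to `H₁` (in particular to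
`torusOp n M a = −Δ^η + aQ*Q` on the torus type) by `−ρ‖w‖²`, where `ρ` bounds the `(cosh(δ·dist) − 1)`-weighted
absolute row sums of `K` (`conjError_symmKernel_ge_of_lipschitz`, `torusKernel_defect_ge`), and packages the
FINITE-RANGE case (`K(x,y) ≠ 0 ⇒ edist(x,y) ≤ 1`: `ρ = δ²m₂`, `coshRowSum_le_of_range`).  THIS MODULE packages the
INFINITE-RANGE, EXPONENTIALLY-TAILED case, which is the shape in which non-local terms actually occur:

* §1 (two real inequalities).  `cosh_mul_sub_one_le`: `cosh(λt) − 1 ≤ λ²·(cosh t − 1)` for `0 ≤ λ ≤ 1` and every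
  real `t` — termwise comparison of the power series `cosh r = Σ r^{2n}/(2n)!` (`Real.hasSum_cosh`) with the `n = 0`
  term removed: `λ^{2n} ≤ λ²` for `n ≥ 1`.  Rate form `cosh_sub_one_le_rate`: `cosh(δs) − 1 ≤ (δ/κ)²·(cosh(κs) − 1)`
  for `0 ≤ δ ≤ κ`, `κ > 0`.  (The weight `t ↦ cosh t − 1` is thus CONVEX-LIKE IN THE RATE to second order: halving the
  rate quarters the weight, at every distance.)
* §2 (generic, any finite index type, any "distance" function).  `coshRowSum_le_of_expMoment`: if the exponential
  second moment of `K` at ONE rate `κ` is finite, `Σ_k |K_jk|·(cosh(κ·d(j,k)) − 1) ≤ m` for all `j`, then for EVERY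
  `0 ≤ δ ≤ κ` the Combes–Thomas defect hypothesis holds with `ρ = (δ/κ)²·m` — SECOND ORDER in `δ`; so a decay rate
  `δ > 0` satisfying any smallness condition of the form `c₁δ² + a(e^δ − 1) + ρ(δ) ≤ σ/2` EXISTS for every kernel with a
  finite exponential moment, and it is mesh-free whenever `m` is.  `expMoment_of_range`: a kernel of range `≤ R₀`
  (`K_jk ≠ 0 ⇒ d(j,k) ≤ R₀`, any `R₀ ≥ 0`) with plain absolute row sums `≤ m₀` has exponential moment
  `≤ (cosh(κR₀) − 1)·m₀` at every rate `κ ≥ 0` (so §2 also covers finite ranges `> 1`, which the sibling's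
  `coshRowSum_le_of_range` does not).  `coshRowSum_le_of_pointwise`: a pointwise tail `|K_jk| ≤ A·B_jk` with
  `Σ_k B_jk (cosh(κ d(j,k)) − 1) ≤ m_B` gives moment `≤ A·m_B` (bookkeeping form used when `K` is dominated entrywise
  by a reference kernel).
* §3 (the torus type `T_η = Tor (fine (n+1) M)`, `η = 1/(n+1)`, periods `(n+1)M_μ ≥ 3`, `a > 0`).  For
  `H = torusOp n M a + K`, `K` symmetric with `Σ_y |K(x,y)|·(cosh(κ·edist(x,y)) − 1) ≤ m`:
  **`setDecay_torus_kernel_expMoment`** — under coercivity `σ'‖ω‖² ≤ ⟨ω,Hω⟩`, `0 ≤ δ ≤ min(1,κ)` and the smallness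
  `2dδ² + a(e^δ − 1) + (δ/κ)²m ≤ σ'/2`, for `g` supported in `T` and `S` at `edist`-distance `≥ R` from `T`:
  `Σ_{x∈S} (H⁻¹g)(x)² ≤ (2/σ')² e^{−2δR} Σ_x g(x)²`, for EVERY mesh; **`torusKernel_inv_entry_bound_expMoment`**:
  `|H⁻¹(x,y)| ≤ (2/σ') e^{−δ·edist(x,y)}`.  Both are one-line instances of the sibling's `setDecay_torus_kernel` /
  `torusKernel_inv_entry_bound` with `hρ` supplied by §2.

CONTEXT (not asserted).  `HOME/BETA/AN2.md` §8.11(h) (ii) asks for the conjugation-defect lemma «for exponentially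
decaying kernels (Schur with the decay weight)»; the sibling gives it with an abstract weighted-Schur constant `ρ`, and
this module shows that the natural datum — one exponential moment `m` at some rate `κ` — produces `ρ(δ) = (δ/κ)²m`,
i.e. the hypothesis is of the same (second) order in `δ` as the local Laplacian part `2dδ²`.  Whether a given operator
of Bałaban's list has an `η`-free exponential moment is an instantiation question NOT decided here.  The
Combes–Thomas device is [cite: CombesThomas1973, §II]; everything here is [folklore].

WHAT THIS MODULE DOES NOT GIVE. (i) Any statement about Bałaban's specific non-local operators (`K` is abstract);
(ii) pointwise short-distance (`|x−y|^{2−d}`-type) bounds — Combes–Thomas outputs are `ℓ²`-operator / `(2/σ')`-sized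
entry bounds only; (iii) gradient versions with a kernel term, covariant (`U ≠ 1`) operators, periods `≤ 2`,
non-symmetric `K` (as in the sibling).
-/

open Finset Matrix

namespace Literature.MathematicalPhysics.QuantumFieldTheory.Balaban1983to89.Beta.CombesThomasKernelTail

open B5Prop11Plancherel (Tor fine)
open TorusG0Decay (torusOp edist)
open TorusG0DivDecay (edist_nonneg)
open CombesThomasKernel (setDecay_torus_kernel torusKernel_inv_entry_bound coshWeight_le coshWeight_nonneg)

noncomputable section

/-! ## §1  `cosh(λt) − 1 ≤ λ²(cosh t − 1)` for `0 ≤ λ ≤ 1` -/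

section Real

/-- **Second-order scaling of the Combes–Thomas weight in the rate**: for `0 ≤ λ ≤ 1` and every real `t`,
`cosh(λt) − 1 ≤ λ²·(cosh t − 1)`.  Proof: remove the constant term from the power series
`cosh r = Σ_n r^{2n}/(2n)!` and compare termwise, `(λt)^{2n} = λ^{2n} t^{2n} ≤ λ² t^{2n}` for `n ≥ 1`. [folklore] -/
theorem cosh_mul_sub_one_le {l : ℝ} (hl0 : 0 ≤ l) (hl1 : l ≤ 1) (t : ℝ) :
    Real.cosh (l * t) - 1 ≤ l ^ 2 * (Real.cosh t - 1) := by
  have h1' := (hasSum_nat_add_iff' (f := fun k : ℕ => (l * t) ^ (2 * k) / ((2 * k).factorial : ℝ)) 1).mpr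
    (Real.hasSum_cosh (l * t))
  have h2' := ((hasSum_nat_add_iff' (f := fun k : ℕ => t ^ (2 * k) / ((2 * k).factorial : ℝ)) 1).mpr
    (Real.hasSum_cosh t)).mul_left (l ^ 2)
  simp only [Finset.sum_range_one, mul_zero, pow_zero, Nat.factorial_zero, Nat.cast_one, div_one] at h1' h2'
  refine hasSum_le (fun i => ?_) h1' h2'
  have hf : (0 : ℝ) < ((2 * (i + 1)).factorial : ℝ) := by positivity
  rw [mul_pow, mul_div_assoc]
  refine mul_le_mul_of_nonneg_right ?_ (div_nonneg (by rw [pow_mul]; positivity) hf.le)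
  exact pow_le_pow_of_le_one hl0 hl1 (by omega)

/-- rate form: for `0 < κ`, `0 ≤ δ ≤ κ` and every real `s`, `cosh(δs) − 1 ≤ (δ/κ)²·(cosh(κs) − 1)`. [folklore] -/
theorem cosh_sub_one_le_rate {δ κ : ℝ} (hκ : 0 < κ) (hδ0 : 0 ≤ δ) (hδκ : δ ≤ κ) (s : ℝ) :
    Real.cosh (δ * s) - 1 ≤ (δ / κ) ^ 2 * (Real.cosh (κ * s) - 1) := by
  have h := cosh_mul_sub_one_le (l := δ / κ) (div_nonneg hδ0 hκ.le) ((div_le_one hκ).mpr hδκ) (κ * s)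
  have : δ / κ * (κ * s) = δ * s := by field_simp
  rwa [this] at h

/-- the rate factor is at most one: `(δ/κ)² ≤ 1` for `0 ≤ δ ≤ κ`, `0 < κ` (so an exponential moment `m` at rate
`κ` bounds the defect constant by `m` itself at every smaller rate). [folklore] -/
theorem rate_sq_le_one {δ κ : ℝ} (hκ : 0 < κ) (hδ0 : 0 ≤ δ) (hδκ : δ ≤ κ) : (δ / κ) ^ 2 ≤ 1 := by
  have h1 : δ / κ ≤ 1 := (div_le_one hκ).mpr hδκ
  have h0 : 0 ≤ δ / κ := div_nonneg hδ0 hκ.le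
  nlinarith

end Real

/-! ## §2  Generic: one exponential moment controls the defect hypothesis at every smaller rate -/

section Generic

variable {ι : Type*} [Fintype ι]

/-- **Exponential moment ⇒ weighted-Schur hypothesis, second order in the rate.**  For any real kernel `K`, any
function `dist`, any `0 < κ`, `0 ≤ δ ≤ κ`: if `Σ_k |K_jk| (cosh(κ·dist(j,k)) − 1) ≤ m` for all `j`, then
`Σ_k |K_jk| (cosh(δ·dist(j,k)) − 1) ≤ (δ/κ)²·m` for all `j` — the hypothesis `hρ` of
`CombesThomasKernel.conjError_symmKernel_ge_of_lipschitz` / `torusKernel_defect_ge` with `ρ = (δ/κ)² m`. [folklore] -/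
theorem coshRowSum_le_of_expMoment (K : Matrix ι ι ℝ) (dist : ι → ι → ℝ) {δ κ m : ℝ} (hκ : 0 < κ)
    (hδ0 : 0 ≤ δ) (hδκ : δ ≤ κ) (hm : ∀ j, ∑ k, |K j k| * (Real.cosh (κ * dist j k) - 1) ≤ m) (j : ι) :
    ∑ k, |K j k| * (Real.cosh (δ * dist j k) - 1) ≤ (δ / κ) ^ 2 * m := by
  calc ∑ k, |K j k| * (Real.cosh (δ * dist j k) - 1)
      ≤ ∑ k, |K j k| * ((δ / κ) ^ 2 * (Real.cosh (κ * dist j k) - 1)) :=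
        Finset.sum_le_sum fun k _ =>
          mul_le_mul_of_nonneg_left (cosh_sub_one_le_rate hκ hδ0 hδκ (dist j k)) (abs_nonneg _)
    _ = (δ / κ) ^ 2 * ∑ k, |K j k| * (Real.cosh (κ * dist j k) - 1) := by
        rw [Finset.mul_sum]
        exact Finset.sum_congr rfl fun k _ => by ring
    _ ≤ (δ / κ) ^ 2 * m := mul_le_mul_of_nonneg_left (hm j) (sq_nonneg _)

/-- coarse form: under the same hypotheses the `δ`-weighted row sums are `≤ m` (rate factor dropped; needs
`0 ≤ m`, which follows from the hypothesis at any `j` when `dist ≥ 0`, but is taken as given). [folklore] -/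
theorem coshRowSum_le_of_expMoment' (K : Matrix ι ι ℝ) (dist : ι → ι → ℝ) {δ κ m : ℝ} (hκ : 0 < κ)
    (hδ0 : 0 ≤ δ) (hδκ : δ ≤ κ) (hm0 : 0 ≤ m) (hm : ∀ j, ∑ k, |K j k| * (Real.cosh (κ * dist j k) - 1) ≤ m)
    (j : ι) : ∑ k, |K j k| * (Real.cosh (δ * dist j k) - 1) ≤ m :=
  (coshRowSum_le_of_expMoment K dist hκ hδ0 hδκ hm j).trans
    ((mul_le_mul_of_nonneg_right (rate_sq_le_one hκ hδ0 hδκ) hm0).trans_eq (one_mul m))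

/-- **Finite range `R₀` ⇒ exponential moment**: if `K_jk ≠ 0 ⇒ dist(j,k) ≤ R₀`, `dist ≥ 0`, `0 ≤ κ` and the plain
absolute row sums are `≤ m₀`, then `Σ_k |K_jk| (cosh(κ·dist(j,k)) − 1) ≤ (cosh(κR₀) − 1)·m₀`.  (Any range `R₀ ≥ 0`;
the sibling's `coshRowSum_le_of_range` is the sharper second-moment form for `R₀ ≤ 1`.) [folklore] -/
theorem expMoment_of_range (K : Matrix ι ι ℝ) (dist : ι → ι → ℝ) (hd : ∀ j k, 0 ≤ dist j k) {κ R₀ m₀ : ℝ}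
    (hκ : 0 ≤ κ) (hKr : ∀ j k, K j k ≠ 0 → dist j k ≤ R₀) (hm0 : ∀ j, ∑ k, |K j k| ≤ m₀) (j : ι) :
    ∑ k, |K j k| * (Real.cosh (κ * dist j k) - 1) ≤ (Real.cosh (κ * R₀) - 1) * m₀ := by
  calc ∑ k, |K j k| * (Real.cosh (κ * dist j k) - 1)
      ≤ ∑ k, |K j k| * (Real.cosh (κ * R₀) - 1) := by
        refine Finset.sum_le_sum fun k _ => ?_
        by_cases hK : K j k = 0
        · simp [hK]
        · refine mul_le_mul_of_nonneg_left (coshWeight_le ?_) (abs_nonneg _)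
          rw [abs_of_nonneg (mul_nonneg hκ (hd j k))]
          exact mul_le_mul_of_nonneg_left (hKr j k hK) hκ
    _ = (Real.cosh (κ * R₀) - 1) * ∑ k, |K j k| := by
        rw [Finset.mul_sum]; exact Finset.sum_congr rfl fun k _ => by ring
    _ ≤ (Real.cosh (κ * R₀) - 1) * m₀ := mul_le_mul_of_nonneg_left (hm0 j) (coshWeight_nonneg _)

/-- **Pointwise domination ⇒ exponential moment**: if `|K_jk| ≤ A·B_jk` entrywise with `0 ≤ A` and the reference
kernel `B` has `Σ_k B_jk (cosh(κ·dist(j,k)) − 1) ≤ m_B`, then `K` has exponential moment `≤ A·m_B`. [folklore] -/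
theorem coshRowSum_le_of_pointwise (K B : Matrix ι ι ℝ) (dist : ι → ι → ℝ) {κ A mB : ℝ} (hA : 0 ≤ A)
    (hKB : ∀ j k, |K j k| ≤ A * B j k) (hB : ∀ j, ∑ k, B j k * (Real.cosh (κ * dist j k) - 1) ≤ mB) (j : ι) :
    ∑ k, |K j k| * (Real.cosh (κ * dist j k) - 1) ≤ A * mB := by
  calc ∑ k, |K j k| * (Real.cosh (κ * dist j k) - 1)
      ≤ ∑ k, A * B j k * (Real.cosh (κ * dist j k) - 1) :=
        Finset.sum_le_sum fun k _ => mul_le_mul_of_nonneg_right (hKB j k) (coshWeight_nonneg _)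
    _ = A * ∑ k, B j k * (Real.cosh (κ * dist j k) - 1) := by
        rw [Finset.mul_sum]; exact Finset.sum_congr rfl fun k _ => by ring
    _ ≤ A * mB := mul_le_mul_of_nonneg_left (hB j) hA

end Generic

/-! ## §3  Torus: `H = torusOp n M a + K`, `K` symmetric with one exponential moment -/

section Torus

variable {d : ℕ} (n : ℕ) (M : Fin d → ℕ) [hM : ∀ μ, NeZero (M μ)]

/-- **Set-to-set decay for `torusOp + K`, `K` symmetric with an exponential moment** `Σ_y |K(x,y)|
(cosh(κ·edist(x,y)) − 1) ≤ m` at some rate `κ > 0`: for every `0 ≤ δ ≤ min(1, κ)` with the mesh-free smallness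
`2dδ² + a(e^δ − 1) + (δ/κ)²m ≤ σ'/2` (where `σ'` is a coercivity constant of `H`), `g` supported in `T` and `S` at
`edist`-distance `≥ R` from `T`: `Σ_{x∈S} (H⁻¹g)(x)² ≤ (2/σ')² e^{−2δR} Σ_x g(x)²`.
[cite: CombesThomas1973, §II] [folklore] -/
theorem setDecay_torus_kernel_expMoment (h3 : ∀ μ, 3 ≤ fine (n + 1) M μ) {a δ κ m σ' : ℝ} (ha : 0 < a)
    (hκ : 0 < κ) (hδ0 : 0 ≤ δ) (hδ1 : δ ≤ 1) (hδκ : δ ≤ κ)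
    (K : Matrix (Tor (fine (n + 1) M)) (Tor (fine (n + 1) M)) ℝ) (hKs : ∀ x y, K x y = K y x)
    (hm : ∀ x, ∑ y, |K x y| * (Real.cosh (κ * edist n M x y) - 1) ≤ m) (hσ' : 0 < σ')
    (hpos : ∀ ω : Tor (fine (n + 1) M) → ℝ, σ' * (ω ⬝ᵥ ω) ≤ ω ⬝ᵥ (torusOp n M a + K).mulVec ω)
    (hsmall : 2 * (d : ℝ) * δ ^ 2 + a * (Real.exp δ - 1) + (δ / κ) ^ 2 * m ≤ σ' / 2)
    (S T : Finset (Tor (fine (n + 1) M))) (R : ℝ) (hR : ∀ x ∈ S, ∀ t ∈ T, R ≤ edist n M x t)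
    (g v : Tor (fine (n + 1) M) → ℝ) (hg : ∀ x, x ∉ T → g x = 0) (hv : (torusOp n M a + K).mulVec v = g) :
    ∑ x ∈ S, v x ^ 2 ≤ (2 / σ') ^ 2 * Real.exp (-(2 * (δ * R))) * ∑ x, g x ^ 2 :=
  setDecay_torus_kernel n M h3 ha hδ0 hδ1 K hKs hσ' hpos
    (coshRowSum_le_of_expMoment K (edist n M) hκ hδ0 hδκ hm) hsmall S T R hR g v hg hv

/-- **Entry bound** for the inverse of `torusOp + K`, `K` symmetric with an exponential moment `m` at rate `κ`:
`|H⁻¹(x,y)| ≤ (2/σ') e^{−δ·edist(x,y)}` for every `0 ≤ δ ≤ min(1,κ)` with `2dδ² + a(e^δ − 1) + (δ/κ)²m ≤ σ'/2`.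
[folklore] -/
theorem torusKernel_inv_entry_bound_expMoment (h3 : ∀ μ, 3 ≤ fine (n + 1) M μ) {a δ κ m σ' : ℝ} (ha : 0 < a)
    (hκ : 0 < κ) (hδ0 : 0 ≤ δ) (hδ1 : δ ≤ 1) (hδκ : δ ≤ κ)
    (K : Matrix (Tor (fine (n + 1) M)) (Tor (fine (n + 1) M)) ℝ) (hKs : ∀ x y, K x y = K y x)
    (hm : ∀ x, ∑ y, |K x y| * (Real.cosh (κ * edist n M x y) - 1) ≤ m) (hσ' : 0 < σ')
    (hpos : ∀ ω : Tor (fine (n + 1) M) → ℝ, σ' * (ω ⬝ᵥ ω) ≤ ω ⬝ᵥ (torusOp n M a + K).mulVec ω)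
    (hsmall : 2 * (d : ℝ) * δ ^ 2 + a * (Real.exp δ - 1) + (δ / κ) ^ 2 * m ≤ σ' / 2)
    (x y : Tor (fine (n + 1) M)) :
    |(torusOp n M a + K)⁻¹ x y| ≤ 2 / σ' * Real.exp (-(δ * edist n M x y)) :=
  torusKernel_inv_entry_bound n M h3 ha hδ0 hδ1 K hKs hσ' hpos
    (coshRowSum_le_of_expMoment K (edist n M) hκ hδ0 hδκ hm) hsmall x y

/-- finite range `R₀` on the torus (any `R₀ ≥ 0`, e.g. a kernel coupling sites up to `R₀` blocks apart): plain
absolute row sums `≤ m₀` give the exponential moment `≤ (cosh(κR₀) − 1)·m₀` at every rate `κ ≥ 0`, ready for the two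
theorems above. [folklore] -/
theorem torus_expMoment_of_range {κ R₀ m₀ : ℝ} (hκ : 0 ≤ κ)
    (K : Matrix (Tor (fine (n + 1) M)) (Tor (fine (n + 1) M)) ℝ)
    (hKr : ∀ x y, K x y ≠ 0 → edist n M x y ≤ R₀) (hm0 : ∀ x, ∑ y, |K x y| ≤ m₀) (x : Tor (fine (n + 1) M)) :
    ∑ y, |K x y| * (Real.cosh (κ * edist n M x y) - 1) ≤ (Real.cosh (κ * R₀) - 1) * m₀ :=
  expMoment_of_range K (edist n M) (edist_nonneg n M) hκ hKr hm0 x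

/-- **Existence of a mesh-free rate (sanity check of the smallness shape)**: with `K = 0` (moment `m = 0` at rate
`κ = 1`) the exponential-moment theorem returns the sibling chain's `setDecay_torus` constants
(`σ' = min(2,a)`, smallness `2dδ² + a(e^δ − 1) ≤ min(2,a)/2`). -/
example (h3 : ∀ μ, 3 ≤ fine (n + 1) M μ) {a δ : ℝ} (ha : 0 < a) (hδ0 : 0 ≤ δ) (hδ1 : δ ≤ 1)
    (hsmall : 2 * (d : ℝ) * δ ^ 2 + a * (Real.exp δ - 1) ≤ min 2 a / 2) (x y : Tor (fine (n + 1) M)) :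
    |(torusOp n M a + 0)⁻¹ x y| ≤ 2 / min 2 a * Real.exp (-(δ * edist n M x y)) :=
  torusKernel_inv_entry_bound_expMoment n M h3 ha one_pos hδ0 hδ1 hδ1 0 (fun _ _ => rfl) (m := 0)
    (fun x => by simp) (lt_min two_pos ha)
    (fun ω => by rw [add_zero]; exact TorusG0Decay.coercive_torus n M h3 ha.le ω) (by simpa using hsmall) x y

end Torus

end

end Literature.MathematicalPhysics.QuantumFieldTheory.Balaban1983to89.Beta.CombesThomasKernelTail
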